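import Literature.MathematicalPhysics.QuantumLattice.HubbardTTPrimeGrandCanonicalThermalStatesKMSRows
import Literature.MathematicalPhysics.QuantumLattice.HubbardTTPrimeGrandCanonicalThermalStatesExistence
import Literature.MathematicalPhysics.QuantumLattice.HubbardTTPrimeCanonicalStatesChargedRows
import Literature.MathematicalPhysics.QuantumLattice.InfVolFermionStateWeakLimits
import Literature.MathematicalPhysics.QuantumLattice.XXZInfiniteVolumeEquilibriumStates
import HarnessLib

/-!
# Differential KMS (energy–entropy balance) states of a lattice-fermion interaction — Araki–Moriya's Definition 6.3 —
# and the equilibrium states of the two-dimensional `t–t'` Hubbard model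

Topic `Literature/MathematicalPhysics/QuantumLattice` (family `hubbard`).  The fermion twin of
`HeisenbergAFInfiniteVolumeThermalStates.lean` (`InfVolState.IsDKMSState` for quantum SPIN systems) and of
`DKMSStatesConvexZeroTemperature.lean`; the predicate that NAMES what the tree's `T > 0` row files establish.

**Araki–Moriya** [ArakiMoriya2003] define (Def. 6.3), for the `C*`-dynamics `α_t` of the CAR algebra of a lattice-fermion
system with generator `δ`: a state `φ` is a `(δ, β)`-**dKMS state** if for every `A` in the domain of `δ`
`(C-1)` `φ(A⋆ δA)` is purely imaginary, and `(C-2)` `−iβ φ(A⋆δA) ≥ S(φ(AA⋆), φ(A⋆A))`, `S(x, y) = y log y − y log x`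
(with `S = +∞` if `y > 0 = x`); and prove (Thm. 6.4, with Thm. 5.13 `δ_Φ A = i[H(I), A]` on `𝔄(I₀)`) that for `β > 0` the
dKMS states for `δ_Φ` on the strictly local algebra are EXACTLY the `(α^Φ_t, β)`-KMS states (Bratteli–Robinson II
Thm. 5.3.15: KMS ⟺ energy–entropy balance / Roepstorff–Araki–Sewell auto-correlation bounds; Fawzi–Fawzi–Scalet 2024
Thm. 3.1: KMS ⟺ stationarity + EEB).  So `IsDKMSState` below is the intrinsic definition of «equilibrium state at inverse
temperature `β` of the infinite lattice-fermion system with interaction `Ψ`» — no limits, no translation invariance.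

## Contents (one definition with body; everything else PROVED; no named fact)

* §1 `InfVolFermionState.IsDKMSState ω Ψ R β` — Def. 6.3 in the lattice-local form of the tree's ground-state condition
  `InfVolFermionState.IsGroundState` (its formal `β = +∞` case): for every finite `Λ` and `A ∈ 𝔄_Λ`, with
  `Ã = Γ_{Λ⊆Λ_R}A`, `δA = Ψ.derivation R Λ A = i[H_{Λ_R}, Ã]`: `(C-1)` `Re ω(Ãᴴ δA) = 0`; the `+∞`-clause
  `0 < Re ω(AᴴA) → 0 < Re ω(AAᴴ)`; `(C-2)` `Re ω(AᴴA)·log(Re ω(AᴴA)/Re ω(AAᴴ)) ≤ β·Re(−i ω(Ãᴴ δA))`.  API: the clauses, the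
  TANGENT rows `θ·Re ω(AᴴA) − e^{θ−1}·Re ω(AAᴴ) ≤ β·Re(−iω(ÃᴴδA))` (`tangent_le`) and conversely `of_tangent`; the bridge
  `of_rows` from the ROW SHAPE of the tree's thermal files — `Im ω(Ãᴴ(H_{Λ_R}Ã − ÃH_{Λ_R})) = 0` and
  `0 ≤ Re ω(β·Ãᴴ(HÃ − ÃH) − s·ÃᴴÃ + q·ÃÃᴴ)` for `e^{s−1} ≤ q` — to `IsDKMSState`; and `(C-1)` from STATIONARITY
  (`im_expect_conjTranspose_mul_commutator_eq_zero_of_stationary`: `ω([K, X⋆X]) = 0`, `K = K⋆` ⇒ `Im ω(X⋆[K, X]) = 0`).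
* §2 STRUCTURE: `dKMSStates Ψ R β` is convex (`IsDKMSState.mix`) and weak⋆-closed, jointly in `β` (`IsDKMSState.of_tendsto`);
  **Bratteli–Kishimoto–Robinson's zero-temperature limit**: pointwise limits of dKMS states at `β_k → +∞` are infinite-volume
  GROUND states (`IsGroundState.of_isDKMSState_tendsto_atTop`), and such limits exist along subsequences
  (`exists_groundState_of_dKMSStates_atTop`, sequential Banach–Alaoglu `InfVolFermionState.exists_tendsto_expect_subseq`).
* §3 **ARAKI–MORIYA THEOREM 12.11**: every translation-invariant solution of the variational principle
  (`IsVarEquilibrium β Ψ R`, `TIVariationalPressure`) of a Hermitian, even, translation-covariant finite-range interaction on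
  `ℤ^d`, `d ≥ 1`, `β ≥ 0`, is a dKMS state at `β` (`IsVarEquilibrium.isDKMSState`) — packaging the rows PROVED in
  `VariationalPrincipleLocalKMSRows`.
* §4 **THE 2D `t–t'` HUBBARD MODEL**: every torus limit `ω` of the grand-canonical Gibbs states of
  `K_L = H_L(t,t',U) − μN − h(N↑−N↓)` at inverse temperature `β` (the tree's thermal grand-canonical class) is a dKMS state at `β`
  of the grand-canonical interaction `gcInteractionTT' t t' U μ h` (`IsTorusLimitOfMixture.isDKMSState_of_gcGibbs`; rows of
  `HubbardTTPrimeGrandCanonicalThermalStatesKMSRows`, `(C-1)` from stationarity); hence for all real `β, t, t', U, μ, h` the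
  grand-canonical `t–t'` Hubbard interaction HAS a translation-invariant, even dKMS state at `β`
  (`exists_isDKMSState_gcInteractionTT'`), and every CANONICAL thermal torus-limit state at density `0 < n < 2` (`U ≥ 0`,
  `β > 0`) is a dKMS state of the grand-canonical dynamics at every supporting chemical potential `μ₀`
  (`IsTorusLimitOfMixture.isDKMSState_of_sectorGibbs`, from `HubbardTTPrimeCanonicalStatesChargedRows`); zero-temperature
  limits of these equilibrium states are ground states of the same interaction (§2).

WHAT THIS IS NOT: the equivalence dKMS ⟺ KMS (Araki–Moriya Thm. 6.4 / Bratteli–Robinson II 5.3.15) is cited, not formalised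
(the `C*`-dynamics `α_t` on the CAR algebra is not constructed in the tree); no uniqueness / high-temperature statement; no number.

## Mathlib / tree search

`lean search 'InfVolFermionState.IsDKMSState|isDKMSState_of_gcGibbs|FermionDKMS'` (2026-08-29): nothing; the spin-side
`InfVolState.IsDKMSState` (`HeisenbergAFInfiniteVolumeThermalStates`) and `DKMSStatesConvexZeroTemperature` are the templates.
REUSED: `FermionInteraction.derivation`, `InfVolFermionState.IsGroundState`, `….mix`, `….norm_expect_le`, `….expect_conjTranspose`,
`….exists_tendsto_expect_subseq`; `IsVarEquilibrium.re_expect_eebRow_nonneg`, `….im_expect_conjTranspose_mul_commutator_eq_zero`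
(`VariationalPrincipleLocalKMSRows`); `IsTorusLimitOfMixture.re_expect_eeb_nonneg_of_gcGibbs`,
`….expect_commutator_gcLocalHamiltonianTT'_eq_zero_of_gcGibbs`, `gcLocalHamiltonianTT'_isHermitian`
(`HubbardTTPrimeGrandCanonicalThermalStatesKMSRows`); `gcInteractionTT'_localHamiltonian`,
`IsTorusLimitOfMixture.exists_chemicalPotential_rows_of_sectorGibbs` (`HubbardTTPrimeCanonicalStatesChargedRows`);
`exists_isTorusLimitOfMixture_gcGibbs_translationInvariant_isEven`; `XXZKT.eeb_clauses_of_tangent`, `mul_sub_exp_mul_le_mul_log_div`.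

## References

* [ArakiMoriya2003] H. Araki, H. Moriya, *Equilibrium statistical mechanics of fermion lattice systems*, Rev. Math. Phys. 15
  (2003) 93–198: Def. 6.3 (C-1), (C-2); Thm. 6.4 (dKMS ⟺ KMS); Thm. 5.13 (`δ_Φ = i[H(I), ·]`); Thm. 12.11 (Var ⇒ dKMS).
* [BratteliRobinsonII1997] O. Bratteli, D. W. Robinson, *Operator Algebras and Quantum Statistical Mechanics 2*, 2nd ed. (1997),
  Thm. 5.3.15 (EEB ⟺ KMS), Thm. 5.3.30 (KMS states: convex, weak⋆-closed), Def. 5.3.18 (ground states), Thm. 6.2.4.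
* [BratteliKishimotoRobinson1978] O. Bratteli, A. Kishimoto, D. W. Robinson, Commun. Math. Phys. 64 (1978) 41–48, §I
  (limits of `β`-KMS states as `β → ∞` are ground states).
* [FawziFawziScalet2024] H. Fawzi, O. Fawzi, S. O. Scalet, Nat. Commun. 15 (2024) 7394 = arXiv:2311.18706, Thm. 3.1.
* [FannesVerbeure1978] M. Fannes, A. Verbeure, J. Math. Phys. 19 (1978) 558 (global stability ⇒ EEB correlation inequalities).
-/

noncomputable section

open scoped ComplexOrder BigOperators Matrix.Norms.L2Operator
open Finset Matrix Literature.InformationTheory.Entropy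

namespace Literature.MathematicalPhysics.QuantumLattice

open Literature.Probability.LatticeModels ThermodynamicLimit _root_.Filter
open scoped _root_.Topology

variable {d : ℕ}

/-! ## §1 Differential KMS states of a lattice-fermion interaction -/

namespace InfVolFermionState

/-- `ω` is a **differential `β`-KMS state** (energy–entropy-balance state) of the finite-range lattice-fermion interaction
`Ψ` (range parameter `R`): Araki–Moriya's Def. 6.3 in the lattice-local form of `InfVolFermionState.IsGroundState` — for every
finite `Λ ⊂ ℤ^d` and `A ∈ 𝔄_Λ` (the CAR algebra of `Λ`), with `Ã = Γ_{Λ⊆Λ_R}A ∈ 𝔄_{Λ_R}` and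
`δA = Ψ.derivation R Λ A = i[H_{Λ_R}, Ã]` (Thm. 5.13):
`(C-1)` `Re ω(Ãᴴ δA) = 0` (`ω(A⋆ δA)` purely imaginary); the `+∞`-clause `0 < Re ω(AᴴA) → 0 < Re ω(AAᴴ)`;
`(C-2)` `Re ω(AᴴA)·log(Re ω(AᴴA)/Re ω(AAᴴ)) ≤ β·Re(−i ω(Ãᴴ δA))` (`= β ω(Ãᴴ[H_{Λ_R}, Ã])`, `S(x,y) = y log y − y log x`).  Lean's
`Real.log 0 = 0`, `x/0 = 0` make the left side of `(C-2)` vanish when either moment does, whence the separate `+∞`-clause.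
For `β > 0` these are exactly the `(α^Ψ, β)`-KMS states of the CAR algebra (Araki–Moriya Thm. 6.4 — not formalised).
[cite: ArakiMoriya2003, Def 6.3 and Thm. 5.13] [cite: BratteliRobinsonII1997, Thm. 5.3.15] -/
def IsDKMSState (ω : InfVolFermionState d) (Ψ : FermionInteraction d) (R β : ℝ) : Prop :=
  ∀ (Λ : Finset (Site d)) (A : FermionOp Λ),
    (ω.expect (thicken Λ R) ((fermionEmbed (PolySite.incl (subset_thicken Λ R)) A)ᴴ * Ψ.derivation R Λ A)).re = 0 ∧
    (0 < (ω.expect Λ (Aᴴ * A)).re → 0 < (ω.expect Λ (A * Aᴴ)).re) ∧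
    (ω.expect Λ (Aᴴ * A)).re * Real.log ((ω.expect Λ (Aᴴ * A)).re / (ω.expect Λ (A * Aᴴ)).re) ≤
      β * (-Complex.I * ω.expect (thicken Λ R)
        ((fermionEmbed (PolySite.incl (subset_thicken Λ R)) A)ᴴ * Ψ.derivation R Λ A)).re

variable {ω : InfVolFermionState d} {Ψ : FermionInteraction d} {R β : ℝ}

/-- `(C-1)` of a dKMS state. [cite: ArakiMoriya2003, Def 6.3 (C-1)] -/
theorem IsDKMSState.re_expect_conjTranspose_mul_derivation (h : ω.IsDKMSState Ψ R β) (Λ : Finset (Site d))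
    (A : FermionOp Λ) :
    (ω.expect (thicken Λ R) ((fermionEmbed (PolySite.incl (subset_thicken Λ R)) A)ᴴ * Ψ.derivation R Λ A)).re = 0 :=
  (h Λ A).1

/-- The `+∞`-clause of `(C-2)`: `ω(AᴴA) > 0 ⇒ ω(AAᴴ) > 0`. [cite: ArakiMoriya2003, Def 6.3 (C-2)] -/
theorem IsDKMSState.re_pos_of_re_pos (h : ω.IsDKMSState Ψ R β) (Λ : Finset (Site d)) (A : FermionOp Λ)
    (hA : 0 < (ω.expect Λ (Aᴴ * A)).re) : 0 < (ω.expect Λ (A * Aᴴ)).re :=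
  (h Λ A).2.1 hA

/-- `(C-2)` of a dKMS state (finite part). [cite: ArakiMoriya2003, Def 6.3 (C-2)] -/
theorem IsDKMSState.mul_log_div_le (h : ω.IsDKMSState Ψ R β) (Λ : Finset (Site d)) (A : FermionOp Λ) :
    (ω.expect Λ (Aᴴ * A)).re * Real.log ((ω.expect Λ (Aᴴ * A)).re / (ω.expect Λ (A * Aᴴ)).re) ≤
      β * (-Complex.I * ω.expect (thicken Λ R)
        ((fermionEmbed (PolySite.incl (subset_thicken Λ R)) A)ᴴ * Ψ.derivation R Λ A)).re :=
  (h Λ A).2.2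

/-- `Re ω(AᴴA) ≥ 0`. [cite: BratteliRobinsonII1997, §6.2.1] -/
theorem re_expect_conjTranspose_mul_self_nonneg' (ω : InfVolFermionState d) (Λ : Finset (Site d)) (A : FermionOp Λ) :
    0 ≤ (ω.expect Λ (Aᴴ * A)).re :=
  (Complex.nonneg_iff.1 (ω.expect_nonneg Λ A)).1

/-- `Re ω(AAᴴ) ≥ 0`. [cite: BratteliRobinsonII1997, §6.2.1] -/
theorem re_expect_mul_conjTranspose_self_nonneg' (ω : InfVolFermionState d) (Λ : Finset (Site d)) (A : FermionOp Λ) :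
    0 ≤ (ω.expect Λ (A * Aᴴ)).re := by
  have := ω.expect_nonneg Λ Aᴴ
  rw [conjTranspose_conjTranspose] at this
  exact (Complex.nonneg_iff.1 this).1

/-- `Re ω(AAᴴ) ≤ ‖AAᴴ‖` (states are contractive). [cite: BratteliRobinsonI1987, Prop. 2.3.11] -/
theorem re_expect_mul_conjTranspose_self_le_norm' (ω : InfVolFermionState d) (Λ : Finset (Site d)) (A : FermionOp Λ) :
    (ω.expect Λ (A * Aᴴ)).re ≤ ‖A * Aᴴ‖ :=
  (Complex.re_le_norm _).trans (ω.norm_expect_le Λ (A * Aᴴ))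

/-- **The tangent (linear) EEB rows of a dKMS state**: for every local `A` and real `θ`,
`θ·Re ω(AᴴA) − e^{θ−1}·Re ω(AAᴴ) ≤ β·Re(−i ω(Ãᴴ δA))` (the supporting lines of the convex constraint `(C-2)`).
[cite: ArakiMoriya2003, Def 6.3 (C-2)] [cite: FawziFawziScalet2024, Thm. 3.1 (5)] -/
theorem IsDKMSState.tangent_le (h : ω.IsDKMSState Ψ R β) (Λ : Finset (Site d)) (A : FermionOp Λ) (θ : ℝ) :
    θ * (ω.expect Λ (Aᴴ * A)).re - Real.exp (θ - 1) * (ω.expect Λ (A * Aᴴ)).re ≤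
      β * (-Complex.I * ω.expect (thicken Λ R)
        ((fermionEmbed (PolySite.incl (subset_thicken Λ R)) A)ᴴ * Ψ.derivation R Λ A)).re := by
  obtain ⟨-, h2, h3⟩ := h Λ A
  have hx := ω.re_expect_conjTranspose_mul_self_nonneg' Λ A
  have hy := ω.re_expect_mul_conjTranspose_self_nonneg' Λ A
  rcases hx.eq_or_lt with hx0 | hxpos
  · rw [← hx0] at h3 ⊢
    have h0 : (0 : ℝ) ≤ β * (-Complex.I * ω.expect (thicken Λ R)
        ((fermionEmbed (PolySite.incl (subset_thicken Λ R)) A)ᴴ * Ψ.derivation R Λ A)).re := by simpa using h3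
    nlinarith [mul_nonneg (Real.exp_pos (θ - 1)).le hy]
  · exact (mul_sub_exp_mul_le_mul_log_div hx (h2 hxpos) θ).trans h3

/-- **dKMS from `(C-1)` and the tangent rows** (their supremum over `θ` is `(C-2)` with its `+∞`-clause).
[cite: ArakiMoriya2003, Def 6.3] [cite: FawziFawziScalet2024, Thm. 3.1 (5)] -/
theorem IsDKMSState.of_tangent
    (h1 : ∀ (Λ : Finset (Site d)) (A : FermionOp Λ),
      (ω.expect (thicken Λ R) ((fermionEmbed (PolySite.incl (subset_thicken Λ R)) A)ᴴ * Ψ.derivation R Λ A)).re = 0)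
    (ht : ∀ (Λ : Finset (Site d)) (A : FermionOp Λ) (θ : ℝ),
      θ * (ω.expect Λ (Aᴴ * A)).re - Real.exp (θ - 1) * (ω.expect Λ (A * Aᴴ)).re ≤
        β * (-Complex.I * ω.expect (thicken Λ R)
          ((fermionEmbed (PolySite.incl (subset_thicken Λ R)) A)ᴴ * Ψ.derivation R Λ A)).re) :
    ω.IsDKMSState Ψ R β := by
  intro Λ A
  obtain ⟨h2, h3⟩ := XXZKT.eeb_clauses_of_tangent (ω.re_expect_conjTranspose_mul_self_nonneg' Λ A)
    (ω.re_expect_mul_conjTranspose_self_nonneg' Λ A) (ht Λ A)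
  exact ⟨h1 Λ A, h2, h3⟩

/-- The derivation row in commutator form: `−i·ω(Ãᴴ δA) = ω(Ãᴴ(H_{Λ_R}Ã − ÃH_{Λ_R}))` and
`Re ω(Ãᴴ δA) = −Im ω(Ãᴴ(H_{Λ_R}Ã − ÃH_{Λ_R}))` (`δA = i[H_{Λ_R}, Ã]`). [cite: ArakiMoriya2003, Thm. 5.13] -/
theorem expect_conjTranspose_mul_derivation_eq (ω : InfVolFermionState d) (Ψ : FermionInteraction d) (R : ℝ)
    (Λ : Finset (Site d)) (A : FermionOp Λ) :
    ω.expect (thicken Λ R) ((fermionEmbed (PolySite.incl (subset_thicken Λ R)) A)ᴴ * Ψ.derivation R Λ A) =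
      Complex.I * ω.expect (thicken Λ R) ((fermionEmbed (PolySite.incl (subset_thicken Λ R)) A)ᴴ *
        (Ψ.localHamiltonian (thicken Λ R) * fermionEmbed (PolySite.incl (subset_thicken Λ R)) A -
          fermionEmbed (PolySite.incl (subset_thicken Λ R)) A * Ψ.localHamiltonian (thicken Λ R))) := by
  rw [FermionInteraction.derivation, Matrix.mul_smul, map_smul, smul_eq_mul]

/-- **dKMS FROM THE ROW SHAPE OF THE TREE'S THERMAL FILES**: if for every local `A` (window `Λ_R = thicken Λ R`)
`(C-1)` `Im ω(Ãᴴ(H_{Λ_R}Ã − ÃH_{Λ_R})) = 0` and the linearised EEB rows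
`0 ≤ Re ω(β·Ãᴴ(H_{Λ_R}Ã − ÃH_{Λ_R}) − s·ÃᴴÃ + q·ÃÃᴴ)` hold whenever `e^{s−1} ≤ q`, then `ω` is a dKMS state of `Ψ` at `β`.
[cite: ArakiMoriya2003, Def 6.3] [cite: FawziFawziScalet2024, Thm. 3.1 (4)–(5)] -/
theorem IsDKMSState.of_rows
    (h1 : ∀ (Λ : Finset (Site d)) (A : FermionOp Λ),
      (ω.expect (thicken Λ R) ((fermionEmbed (PolySite.incl (subset_thicken Λ R)) A)ᴴ *
        (Ψ.localHamiltonian (thicken Λ R) * fermionEmbed (PolySite.incl (subset_thicken Λ R)) A -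
          fermionEmbed (PolySite.incl (subset_thicken Λ R)) A * Ψ.localHamiltonian (thicken Λ R)))).im = 0)
    (hrow : ∀ (Λ : Finset (Site d)) (A : FermionOp Λ) (s q : ℝ), Real.exp (s - 1) ≤ q →
      0 ≤ (ω.expect (thicken Λ R)
        (((β : ℝ) : ℂ) • ((fermionEmbed (PolySite.incl (subset_thicken Λ R)) A)ᴴ *
            (Ψ.localHamiltonian (thicken Λ R) * fermionEmbed (PolySite.incl (subset_thicken Λ R)) A -
              fermionEmbed (PolySite.incl (subset_thicken Λ R)) A * Ψ.localHamiltonian (thicken Λ R))) -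
          ((s : ℝ) : ℂ) • ((fermionEmbed (PolySite.incl (subset_thicken Λ R)) A)ᴴ *
            fermionEmbed (PolySite.incl (subset_thicken Λ R)) A) +
          ((q : ℝ) : ℂ) • (fermionEmbed (PolySite.incl (subset_thicken Λ R)) A *
            (fermionEmbed (PolySite.incl (subset_thicken Λ R)) A)ᴴ))).re) :
    ω.IsDKMSState Ψ R β := by
  refine IsDKMSState.of_tangent (fun Λ A => ?_) (fun Λ A θ => ?_)
  · rw [expect_conjTranspose_mul_derivation_eq, Complex.I_mul_re, h1 Λ A, neg_zero]
  · have h := hrow Λ A θ (Real.exp (θ - 1)) le_rfl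
    have hAA : ω.expect (thicken Λ R) ((fermionEmbed (PolySite.incl (subset_thicken Λ R)) A)ᴴ *
        fermionEmbed (PolySite.incl (subset_thicken Λ R)) A) = ω.expect Λ (Aᴴ * A) := by
      rw [← fermionEmbed_conjTranspose, ← fermionEmbed_mul, ω.compatible]
    have hAA' : ω.expect (thicken Λ R) (fermionEmbed (PolySite.incl (subset_thicken Λ R)) A *
        (fermionEmbed (PolySite.incl (subset_thicken Λ R)) A)ᴴ) = ω.expect Λ (A * Aᴴ) := by
      rw [← fermionEmbed_conjTranspose, ← fermionEmbed_mul, ω.compatible]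
    rw [map_add, map_sub, map_smul, map_smul, map_smul, hAA, hAA', smul_eq_mul, smul_eq_mul, smul_eq_mul, Complex.add_re,
      Complex.sub_re, Complex.re_ofReal_mul, Complex.re_ofReal_mul, Complex.re_ofReal_mul] at h
    rw [expect_conjTranspose_mul_derivation_eq, ← mul_assoc, show -Complex.I * Complex.I = 1 by
      rw [neg_mul, Complex.I_mul_I, neg_neg], one_mul]
    linarith

/-- **`(C-1)` from stationarity**: if `K ∈ 𝔄_{Λ'}` is Hermitian and `ω(K·X⋆X − X⋆X·K) = 0`, then `Im ω(X⋆(KX − XK)) = 0`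
(`ω(X⋆KX)` is real as the expectation of a Hermitian element, and `ω(X⋆XK) = ω(KX⋆X) = conj ω(X⋆XK)` is real).
[cite: FawziFawziScalet2024, Thm. 3.1 (4)] [cite: BratteliRobinsonII1997, Thm. 5.3.15] -/
theorem im_expect_conjTranspose_mul_commutator_eq_zero_of_stationary (ω : InfVolFermionState d) {Λ' : Finset (Site d)}
    {K : FermionOp Λ'} (hK : K.IsHermitian) (X : FermionOp Λ') (hstat : ω.expect Λ' (K * (Xᴴ * X) - Xᴴ * X * K) = 0) :
    (ω.expect Λ' (Xᴴ * (K * X - X * K))).im = 0 := by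
  have h1 : (ω.expect Λ' (Xᴴ * K * X)).im = 0 := by
    have hh : (Xᴴ * K * X)ᴴ = Xᴴ * K * X := by
      rw [conjTranspose_mul, conjTranspose_mul, conjTranspose_conjTranspose, hK.eq, Matrix.mul_assoc]
    have h := ω.expect_conjTranspose Λ' (Xᴴ * K * X)
    rw [hh] at h
    have := congrArg Complex.im h
    rw [Complex.star_def, Complex.conj_im] at this
    linarith
  have h2 : (ω.expect Λ' (Xᴴ * X * K)).im = 0 := by
    have hs : ω.expect Λ' (K * (Xᴴ * X)) = ω.expect Λ' (Xᴴ * X * K) := by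
      rw [map_sub] at hstat
      exact sub_eq_zero.1 hstat
    have hh : (Xᴴ * X * K)ᴴ = K * (Xᴴ * X) := by
      rw [conjTranspose_mul, conjTranspose_mul, conjTranspose_conjTranspose, hK.eq, ← Matrix.mul_assoc]
    have h := ω.expect_conjTranspose Λ' (Xᴴ * X * K)
    rw [hh, hs] at h
    have := congrArg Complex.im h
    rw [Complex.star_def, Complex.conj_im] at this
    linarith
  rw [Matrix.mul_sub, ← Matrix.mul_assoc, ← Matrix.mul_assoc, map_sub, Complex.sub_im, h1, h2, sub_zero]

end InfVolFermionState

/-! ## §2 Structure of the set of dKMS states: convexity, weak⋆-closedness, zero-temperature limits -/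

/-- The set of dKMS (energy–entropy-balance) states of the lattice-fermion interaction `Ψ` (range `R`) at inverse
temperature `β`. [cite: ArakiMoriya2003, Def 6.3] [cite: BratteliRobinsonII1997, Thm. 5.3.30] -/
def fermionDKMSStates (Ψ : FermionInteraction d) (R β : ℝ) : Set (InfVolFermionState d) :=
  {ω | ω.IsDKMSState Ψ R β}

/-- Membership in `fermionDKMSStates`. [cite: ArakiMoriya2003, Def 6.3] -/
theorem mem_fermionDKMSStates_iff {Ψ : FermionInteraction d} {R β : ℝ} {ω : InfVolFermionState d} :
    ω ∈ fermionDKMSStates Ψ R β ↔ ω.IsDKMSState Ψ R β :=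
  Iff.rfl

namespace InfVolFermionState

variable {Ψ : FermionInteraction d} {R β : ℝ}

/-- Real part of a convex combination of expectations rotated by `−i`. [folklore] -/
private theorem re_negI_mul_mix (t : ℝ) (z₁ z₂ : ℂ) :
    (-Complex.I * ((t : ℂ) * z₁ + ((1 - t : ℝ) : ℂ) * z₂)).re =
      t * (-Complex.I * z₁).re + (1 - t) * (-Complex.I * z₂).re := by
  rw [mul_add, mul_left_comm (-Complex.I) (t : ℂ) z₁, mul_left_comm (-Complex.I) ((1 - t : ℝ) : ℂ) z₂,
    Complex.add_re, Complex.re_ofReal_mul, Complex.re_ofReal_mul]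

/-- **Convex combinations of dKMS states are dKMS states** (all defining rows are linear in `ω` once `(C-2)` is replaced
by its tangent family). [cite: BratteliRobinsonII1997, Thm. 5.3.30 (1)] [cite: ArakiMoriya2003, Def 6.3] -/
theorem IsDKMSState.mix {ω₁ ω₂ : InfVolFermionState d} (h₁ : ω₁.IsDKMSState Ψ R β) (h₂ : ω₂.IsDKMSState Ψ R β)
    (t : ℝ) (ht₀ : 0 ≤ t) (ht₁ : t ≤ 1) : (InfVolFermionState.mix t ht₀ ht₁ ω₁ ω₂).IsDKMSState Ψ R β := by
  refine IsDKMSState.of_tangent (fun Λ A => ?_) (fun Λ A θ => ?_)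
  · rw [mix_expect, Complex.add_re, Complex.re_ofReal_mul, Complex.re_ofReal_mul,
      h₁.re_expect_conjTranspose_mul_derivation Λ A, h₂.re_expect_conjTranspose_mul_derivation Λ A, mul_zero,
      mul_zero, add_zero]
  · have r1 := h₁.tangent_le Λ A θ
    have r2 := h₂.tangent_le Λ A θ
    rw [mix_expect, mix_expect, mix_expect, re_negI_mul_mix, Complex.add_re, Complex.add_re,
      Complex.re_ofReal_mul, Complex.re_ofReal_mul, Complex.re_ofReal_mul, Complex.re_ofReal_mul]
    have ht₁' : 0 ≤ 1 - t := sub_nonneg.2 ht₁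
    nlinarith [mul_le_mul_of_nonneg_left r1 ht₀, mul_le_mul_of_nonneg_left r2 ht₁']

/-- `fermionDKMSStates Ψ R β` is convex. [cite: BratteliRobinsonII1997, Thm. 5.3.30 (1)] -/
theorem mix_mem_fermionDKMSStates {ω₁ ω₂ : InfVolFermionState d} (h₁ : ω₁ ∈ fermionDKMSStates Ψ R β)
    (h₂ : ω₂ ∈ fermionDKMSStates Ψ R β) (t : ℝ) (ht₀ : 0 ≤ t) (ht₁ : t ≤ 1) :
    InfVolFermionState.mix t ht₀ ht₁ ω₁ ω₂ ∈ fermionDKMSStates Ψ R β :=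
  IsDKMSState.mix h₁ h₂ t ht₀ ht₁

/-- **Weak⋆-closedness of the dKMS states, jointly in `β`**: if `ω_k` is a dKMS state at `β_k`, `β_k → β`, and `ω_k → ω` on
every local algebra, then `ω` is a dKMS state at `β`. [cite: BratteliRobinsonII1997, Thm. 5.3.30 (1) and Thm. 5.3.25]
[cite: ArakiMoriya2003, Def 6.3] -/
theorem IsDKMSState.of_tendsto {ωk : ℕ → InfVolFermionState d} {βk : ℕ → ℝ} {β : ℝ} {ω : InfVolFermionState d}
    (hk : ∀ k, (ωk k).IsDKMSState Ψ R (βk k)) (hβ : Tendsto βk atTop (𝓝 β))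
    (hlim : ∀ (Λ : Finset (Site d)) (A : FermionOp Λ), Tendsto (fun k => (ωk k).expect Λ A) atTop (𝓝 (ω.expect Λ A))) :
    ω.IsDKMSState Ψ R β := by
  refine IsDKMSState.of_tangent (fun Λ A => ?_) (fun Λ A θ => ?_)
  · have h := (Complex.continuous_re.tendsto _).comp
      (hlim (thicken Λ R) ((fermionEmbed (PolySite.incl (subset_thicken Λ R)) A)ᴴ * Ψ.derivation R Λ A))
    rw [show ((fun z : ℂ => z.re) ∘ fun k => (ωk k).expect (thicken Λ R)
        ((fermionEmbed (PolySite.incl (subset_thicken Λ R)) A)ᴴ * Ψ.derivation R Λ A)) = fun _ => (0 : ℝ) from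
      funext fun k => (hk k).re_expect_conjTranspose_mul_derivation Λ A] at h
    exact tendsto_nhds_unique h tendsto_const_nhds
  · have hu := (Complex.continuous_re.tendsto _).comp (hlim Λ (Aᴴ * A))
    have hv := (Complex.continuous_re.tendsto _).comp (hlim Λ (A * Aᴴ))
    have hc := (Complex.continuous_re.tendsto _).comp
      ((hlim (thicken Λ R) ((fermionEmbed (PolySite.incl (subset_thicken Λ R)) A)ᴴ *
        Ψ.derivation R Λ A)).const_mul (-Complex.I))
    exact le_of_tendsto_of_tendsto' ((hu.const_mul θ).sub (hv.const_mul (Real.exp (θ - 1)))) (hβ.mul hc)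
      fun k => (hk k).tangent_le Λ A θ

/-- **THE ZERO-TEMPERATURE LIMIT OF dKMS STATES IS A GROUND STATE** (Bratteli–Kishimoto–Robinson 1978, §I): if `ω_k` is a
dKMS state of `Ψ` at `β_k → +∞` and `ω_k → ω` on every local algebra, then `ω` is an infinite-volume ground state of `Ψ`
(`InfVolFermionState.IsGroundState`: `−i ω(Ãᴴ δA) ≥ 0` for every local `A`).  `(C-1)` passes to the limit, and the tangent row
at `θ = 0`, `−e^{−1} Re ω_k(AAᴴ) ≤ β_k Re(−iω_k(Ãᴴ δA))` with `Re ω_k(AAᴴ) ≤ ‖AAᴴ‖`, gives `Re(−iω_k(Ãᴴ δA)) ≥ −e^{−1}‖AAᴴ‖/β_k → 0`.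
[cite: BratteliKishimotoRobinson1978, §I (p. 41)] [cite: BratteliRobinsonII1997, Def. 5.3.18] -/
theorem IsGroundState.of_isDKMSState_tendsto_atTop {ωk : ℕ → InfVolFermionState d} {βk : ℕ → ℝ}
    {ω : InfVolFermionState d} (hk : ∀ k, (ωk k).IsDKMSState Ψ R (βk k)) (hβ : Tendsto βk atTop atTop)
    (hlim : ∀ (Λ : Finset (Site d)) (A : FermionOp Λ), Tendsto (fun k => (ωk k).expect Λ A) atTop (𝓝 (ω.expect Λ A))) :
    ω.IsGroundState Ψ R := by
  intro Λ A
  set X : FermionOp (thicken Λ R) := (fermionEmbed (PolySite.incl (subset_thicken Λ R)) A)ᴴ * Ψ.derivation R Λ A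
    with hX
  have hre : (ω.expect (thicken Λ R) X).re = 0 := by
    have h := (Complex.continuous_re.tendsto _).comp (hlim (thicken Λ R) X)
    rw [show ((fun z : ℂ => z.re) ∘ fun k => (ωk k).expect (thicken Λ R) X) = fun _ => (0 : ℝ) from
      funext fun k => (hk k).re_expect_conjTranspose_mul_derivation Λ A] at h
    exact tendsto_nhds_unique h tendsto_const_nhds
  have hc : Tendsto (fun k => (-Complex.I * (ωk k).expect (thicken Λ R) X).re) atTop
      (𝓝 (-Complex.I * ω.expect (thicken Λ R) X).re) :=
    (Complex.continuous_re.tendsto _).comp ((hlim (thicken Λ R) X).const_mul (-Complex.I))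
  have hlow : Tendsto (fun k => -(Real.exp (-1) * ‖A * Aᴴ‖) * (βk k)⁻¹) atTop (𝓝 0) := by
    simpa using (tendsto_inv_atTop_zero.comp hβ).const_mul (-(Real.exp (-1) * ‖A * Aᴴ‖))
  have hev : ∀ᶠ k in atTop, -(Real.exp (-1) * ‖A * Aᴴ‖) * (βk k)⁻¹ ≤
      (-Complex.I * (ωk k).expect (thicken Λ R) X).re := by
    filter_upwards [hβ.eventually_gt_atTop 0] with k hkpos
    have hrow : -(Real.exp (-1) * ((ωk k).expect Λ (A * Aᴴ)).re) ≤
        βk k * (-Complex.I * (ωk k).expect (thicken Λ R) X).re := by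
      have h0 := (hk k).tangent_le Λ A 0
      rw [zero_mul, zero_sub, zero_sub] at h0
      exact h0
    have hv := (ωk k).re_expect_mul_conjTranspose_self_le_norm' Λ A
    rw [← div_eq_mul_inv, div_le_iff₀ hkpos]
    have he : 0 < Real.exp (-1) := Real.exp_pos _
    nlinarith [mul_le_mul_of_nonneg_left hv he.le]
  have hc0 : 0 ≤ (-Complex.I * ω.expect (thicken Λ R) X).re := le_of_tendsto_of_tendsto hlow hc hev
  refine Complex.nonneg_iff.2 ⟨hc0, ?_⟩
  simp [Complex.mul_im, hre]

/-- **Zero-temperature limits exist** along subsequences (sequential Banach–Alaoglu for the CAR algebra) and are ground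
states. [cite: BratteliKishimotoRobinson1978, §I (p. 41)] [cite: BratteliRobinsonI1987, Thm. 2.3.15] -/
theorem exists_groundState_of_dKMSStates_atTop {ωk : ℕ → InfVolFermionState d} {βk : ℕ → ℝ}
    (hk : ∀ k, (ωk k).IsDKMSState Ψ R (βk k)) (hβ : Tendsto βk atTop atTop) :
    ∃ φ : ℕ → ℕ, StrictMono φ ∧ ∃ ω : InfVolFermionState d, ω.IsGroundState Ψ R ∧
      ∀ (Λ : Finset (Site d)) (A : FermionOp Λ), Tendsto (fun k => (ωk (φ k)).expect Λ A) atTop (𝓝 (ω.expect Λ A)) := by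
  obtain ⟨φ, hφ, ω, hlim⟩ := InfVolFermionState.exists_tendsto_expect_subseq ωk
  exact ⟨φ, hφ, ω, IsGroundState.of_isDKMSState_tendsto_atTop (fun k => hk (φ k)) (hβ.comp hφ.tendsto_atTop) hlim, hlim⟩

end InfVolFermionState

/-! ## §3 Araki–Moriya's Theorem 12.11: solutions of the variational principle are dKMS states -/

namespace InfVolFermionState

variable (hd : 0 < d) {Ψ : FermionInteraction d} {R : ℝ} (hH : Ψ.IsHermitian) (hE : Ψ.IsEven)
  (hT : Ψ.IsTranslationInvariant) (hR : Ψ.HasFiniteRange R) {β : ℝ} (hβ : 0 ≤ β) {ω : InfVolFermionState d}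
include hd hH hE hT hR hβ

/-- **ARAKI–MORIYA, THEOREM 12.11** (variational principle ⇒ dKMS), in the tree's formalism: every translation-invariant
solution of the variational principle of a Hermitian, even, translation-covariant interaction `Ψ` of finite range `R` on `ℤ^d`,
`d ≥ 1`, at `β ≥ 0` — every `IsVarEquilibrium β Ψ R` state — is a dKMS state of `Ψ` at `β`.  (The rows are the tree's
`IsVarEquilibrium.re_expect_eebRow_nonneg` and `….im_expect_conjTranspose_mul_commutator_eq_zero`, proved in
`VariationalPrincipleLocalKMSRows` by the pressure-perturbation argument.) [cite: ArakiMoriya2003, Theorem 12.11 and Def 6.3]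
[cite: FannesVerbeure1978] -/
theorem IsVarEquilibrium.isDKMSState (h : ω.IsVarEquilibrium β Ψ R) : ω.IsDKMSState Ψ R β :=
  IsDKMSState.of_rows
    (fun _ A => h.im_expect_conjTranspose_mul_commutator_eq_zero hd hH hE hT hR hβ subset_rfl A)
    (fun _ A _ _ hq => h.re_expect_eebRow_nonneg hd hH hE hT hR hβ subset_rfl A hq)

/-- The same in set form. [cite: ArakiMoriya2003, Theorem 12.11] -/
theorem IsVarEquilibrium.mem_fermionDKMSStates (h : ω.IsVarEquilibrium β Ψ R) : ω ∈ fermionDKMSStates Ψ R β :=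
  h.isDKMSState hd hH hE hT hR hβ

end InfVolFermionState

/-! ## §4 The equilibrium states of the two-dimensional `t–t'` Hubbard model are dKMS states -/

namespace InfVolFermionState

section GrandCanonical

variable {β : ℝ} (t t' U μ hz : ℝ) {ω : InfVolFermionState 2} {Ls : ℕ → ℕ}

/-- **THERMAL GRAND-CANONICAL STATES OF THE 2D `t–t'` HUBBARD MODEL ARE dKMS STATES.**  Every torus limit `ω` of the
grand-canonical Gibbs states `e^{−βK_L}/tr e^{−βK_L}`, `K_L = H_L(t,t',U) − μN − h(N↑ − N↓)`, along sides `Ls → ∞` is a dKMS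
state at `β` of the grand-canonical `t–t'` Hubbard interaction `gcInteractionTT' t t' U μ h` (range `1`), whose local
Hamiltonians are the `K_Λ` (`gcInteractionTT'_localHamiltonian`): the EEB rows are
`IsTorusLimitOfMixture.re_expect_eeb_nonneg_of_gcGibbs`, and `(C-1)` follows from the stationarity rows
`….expect_commutator_gcLocalHamiltonianTT'_eq_zero_of_gcGibbs` applied to `AᴴA` (`K_Λ` Hermitian).  All real `β, t, t', U, μ, h`.
[cite: ArakiMoriya2003, Def 6.3, Thm. 6.4] [cite: FawziFawziScalet2024, Thm. 3.1] [cite: BratteliRobinsonII1997, Thm. 5.3.15] -/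
theorem IsTorusLimitOfMixture.isDKMSState_of_gcGibbs
    (h : ω.IsTorusLimitOfMixture sourcedGibbsCount (gcGibbsWeightTT' β t t' U μ hz) (gcGibbsVectorTT' t t' U μ hz) Ls)
    (hLs : Tendsto Ls atTop atTop) : ω.IsDKMSState (gcInteractionTT' t t' U μ hz) 1 β := by
  refine IsDKMSState.of_rows (fun Λ A => ?_) (fun Λ A s q hq => ?_)
  · rw [gcInteractionTT'_localHamiltonian]
    refine ω.im_expect_conjTranspose_mul_commutator_eq_zero_of_stationary (gcLocalHamiltonianTT'_isHermitian _ t t' U μ hz)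
      _ ?_
    have hs := h.expect_commutator_gcLocalHamiltonianTT'_eq_zero_of_gcGibbs t t' U μ hz hLs (subset_thicken Λ 1) subset_rfl
      (Aᴴ * A)
    rwa [fermionEmbed_mul, fermionEmbed_conjTranspose] at hs
  · rw [gcInteractionTT'_localHamiltonian]
    exact h.re_expect_eeb_nonneg_of_gcGibbs t t' U μ hz hLs (subset_thicken Λ 1) subset_rfl A hq

/-- **THE GRAND-CANONICAL `t–t'` HUBBARD INTERACTION ON `ℤ²` HAS AN EQUILIBRIUM (dKMS) STATE AT EVERY `β`** — indeed a
translation-invariant, even one (a torus limit of grand-canonical Gibbs states, by compactness); all real `β, t, t', U, μ, h`.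
[cite: ArakiMoriya2003, Def 6.3] [cite: BratteliRobinsonII1997, Prop. 6.2.15 (existence of KMS states)] -/
theorem exists_isDKMSState_gcInteractionTT' (β : ℝ) :
    ∃ ω : InfVolFermionState 2, ω.IsDKMSState (gcInteractionTT' t t' U μ hz) 1 β ∧ ω.IsTranslationInvariant ∧ ω.IsEven := by
  obtain ⟨Ls, ω, hLs, hω, hTI, hEv⟩ := exists_isTorusLimitOfMixture_gcGibbs_translationInvariant_isEven β t t' U μ hz
  exact ⟨ω, hω.isDKMSState_of_gcGibbs t t' U μ hz hLs, hTI, hEv⟩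

/-- **Zero-temperature limits of the Hubbard equilibrium states are ground states**: if `ω_k` are dKMS states of
`gcInteractionTT' t t' U μ h` at `β_k → +∞` (e.g. the thermal grand-canonical states above) converging on every local algebra
to `ω`, then `ω` is an infinite-volume ground state of the grand-canonical `t–t'` Hubbard interaction.
[cite: BratteliKishimotoRobinson1978, §I (p. 41)] [cite: ArakiMoriya2003, Def 6.3] -/
theorem isGroundState_gcInteractionTT'_of_dKMS_tendsto_atTop {ωk : ℕ → InfVolFermionState 2} {βk : ℕ → ℝ}
    {ω : InfVolFermionState 2} (hk : ∀ k, (ωk k).IsDKMSState (gcInteractionTT' t t' U μ hz) 1 (βk k))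
    (hβ : Tendsto βk atTop atTop)
    (hlim : ∀ (Λ : Finset (Site 2)) (A : FermionOp Λ), Tendsto (fun k => (ωk k).expect Λ A) atTop (𝓝 (ω.expect Λ A))) :
    ω.IsGroundState (gcInteractionTT' t t' U μ hz) 1 :=
  IsGroundState.of_isDKMSState_tendsto_atTop hk hβ hlim

end GrandCanonical

section Canonical

variable (t t' : ℝ) {U : ℝ} (hU : 0 ≤ U) {β : ℝ} (hβ : 0 < β) {ω : InfVolFermionState 2} {Ls : ℕ → ℕ} {n : ℝ}
include hU hβ

/-- **CANONICAL THERMAL STATES OF THE 2D `t–t'` HUBBARD MODEL ARE dKMS STATES OF THE GRAND-CANONICAL DYNAMICS AT A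
SUPPORTING CHEMICAL POTENTIAL** (`U ≥ 0`, `β > 0`, density `0 < n < 2`): every torus limit `ω` of the canonical Gibbs states
at `(β; t, t', U; n)` is a dKMS state at `β` of `gcInteractionTT' t t' U μ₀ 0` for some `μ₀` with `p(n) = P(μ₀) − βμ₀n`
(Araki–Moriya Thm. 12.11 through the grand-canonical variational principle the canonical state solves; rows of
`HubbardTTPrimeCanonicalStatesChargedRows`, `(C-1)` from stationarity). [cite: ArakiMoriya2003, Theorem 12.11, Def 6.3]
[cite: FawziFawziScalet2024, Thm. 3.1] -/
theorem IsTorusLimitOfMixture.exists_chemicalPotential_isDKMSState_of_sectorGibbs (hn0 : 0 < n) (hn2 : n < 2)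
    (h : ω.IsTorusLimitOfMixture (sectorGibbsCount n) (fun L => sectorGibbsWeightTT' β t t' U n L)
      (fun L => sectorGibbsVectorTT' t t' U n L) Ls)
    (hLs : Tendsto Ls atTop atTop) :
    ∃ μ₀ : ℝ, pressureTT' β t t' U n = gcPressureTT' β t t' U μ₀ - β * μ₀ * n ∧
      ω.IsDKMSState (gcInteractionTT' t t' U μ₀ 0) 1 β := by
  obtain ⟨μ₀, hμ₀, hrows⟩ := h.exists_chemicalPotential_rows_of_sectorGibbs t t' hU hβ hn0 hn2 hLs
  refine ⟨μ₀, hμ₀, IsDKMSState.of_rows (fun Λ A => ?_) (fun Λ A s q hq => ?_)⟩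
  · rw [gcInteractionTT'_localHamiltonian]
    refine ω.im_expect_conjTranspose_mul_commutator_eq_zero_of_stationary (gcLocalHamiltonianTT'_isHermitian _ t t' U μ₀ 0)
      _ ?_
    have hs := (hrows (subset_thicken Λ 1) subset_rfl (Aᴴ * A)).1
    rwa [fermionEmbed_mul, fermionEmbed_conjTranspose] at hs
  · rw [gcInteractionTT'_localHamiltonian]
    exact (hrows (subset_thicken Λ 1) subset_rfl A).2 s q hq

end Canonical

end InfVolFermionState

end Literature.MathematicalPhysics.QuantumLattice

end
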